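import Summits.Ventures.PercRepro.ThetaOmegaCoreSquareMain

/-!
# (Σ) is strict unless two members are disjoint or two members cover the ground set

Dossier proofs/MINE1-theoremS.md, Addendum 83 / proofs/MINE1-sigma-proof.md §1 (mine-1, gen 44).
The bridge `card_le_card_sigmaD_of_conjOmega` of `ThetaOmega.lean` counts the `A`-family of the
all-anti coloured family of a (Σ)-instance inside the `p`-free part of `sigmaD U X`. In the all-anti
colouring no member has `c0 s = c1 s`, so `∅` is never a difference `s \ s`: it enters the `A`-family
only as a meet of two disjoint members of `X`, as a meet of two complements (two members of `X`
covering `U`), or as a difference `s \ t = ∅` of a member and a complement — again a disjoint pair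
or a covering pair of `X` (`empty_notMem_omegaA_sigmaOmegaFam`). Since `∅ ∈ sigmaD U X` always,
the `p`-free part has one element more than the `A`-family in that case, and (Ω) gives

* `card_add_one_le_card_sigmaD_of_conjOmega` — `|X| + 1 ≤ |sigmaD U X|` for a valid instance with
  at least three members, no two of which are disjoint or cover `U` (relative to a ground set with
  a point), from (Ω);
* `card_add_one_le_card_sigmaD` — the same unconditionally, from `conjOmega_holds`: **(Σ) is
  strict on every intersecting, co-intersecting instance with at least three members** — the part
  of the strictness conjecture (Σ⁺) of Addendum 76 suppl. 4 that (Ω) settles outright.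
-/

namespace PercRepro.MSTight

open Finset

variable {α : Type*} [DecidableEq α]

section SigmaStrict

variable {U : Finset α} {X : Finset (Finset α)} {p : α}

/-- In the all-anti colouring of the family of a (Σ)-instance at `p`, `∅` enters the `A`-family
only through two distinct members of `X` that are disjoint or that cover `U`. -/
theorem empty_notMem_omegaA_sigmaOmegaFam (hv : SigmaValidRel U X)
    (hdisj : ∀ x ∈ X, ∀ y ∈ X, x ≠ y → x ⊓ y ≠ ∅)
    (hcov : ∀ x ∈ X, ∀ y ∈ X, x ≠ y → x ⊔ y ≠ U) :
    ∅ ∉ omegaA (sigmaOmegaFam U p X) (sigmaC0 X) (sigmaC1 X) := by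
  intro hE
  rcases mem_omegaA.1 hE with ⟨s, hs, t, ht, hst, hc, h⟩ | ⟨s, hs, t, ht, hc, h⟩
  · -- a meet of two distinct members of the same `c0`-colour
    rcases mem_sigmaOmegaFam.1 hs with ⟨hsX, hps⟩ | ⟨x, hx, hpx, rfl⟩ <;>
      rcases mem_sigmaOmegaFam.1 ht with ⟨htX, hpt⟩ | ⟨y, hy, hpy, rfl⟩
    · exact hdisj s hsX t htX hst h
    · simp only [sigmaC0, decide_eq_decide] at hc
      exact hc.2 (sdiff_notMem_of_valid hv hy) hsX
    · simp only [sigmaC0, decide_eq_decide] at hc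
      exact hc.1 (sdiff_notMem_of_valid hv hx) htX
    · -- two complements with empty meet: `x ⊔ y = U`
      have hxy : x ≠ y := fun h' => hst (h' ▸ rfl)
      apply hcov x hx y hy hxy
      rw [inf_eq_inter, ← sdiff_union_distrib, sdiff_eq_empty_iff_subset] at h
      exact le_antisymm (union_subset (hv.1 x hx) (hv.1 y hy)) h
  · -- a difference `s \ t = ∅` with `c0 s = c1 t`
    rcases mem_sigmaOmegaFam.1 hs with ⟨hsX, hps⟩ | ⟨x, hx, hpx, rfl⟩ <;>
      rcases mem_sigmaOmegaFam.1 ht with ⟨htX, hpt⟩ | ⟨y, hy, hpy, rfl⟩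
    · simp only [sigmaC0, sigmaC1, decide_eq_decide] at hc
      exact hc.2 htX hsX
    · -- `s ∈ X`, `t = U \ y`: `s ⊆ U \ y` makes `s` and `y` disjoint
      have hsy : s ≠ y := fun h' => hps (by rw [h']; exact hpy)
      apply hdisj s hsX y hy hsy
      rw [sdiff_eq_empty_iff_subset, subset_sdiff] at h
      exact disjoint_iff_inter_eq_empty.1 h.2
    · -- `s = U \ x`, `t ∈ X`: `U \ x ⊆ t` makes `x` and `t` cover `U`
      have hxt : x ≠ t := fun h' => hpt (by rw [← h']; exact hpx)
      apply hcov x hx t htX hxt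
      rw [sdiff_eq_empty_iff_subset] at h
      exact le_antisymm (union_subset (hv.1 x hx) (hv.1 t htX)) (sdiff_le_iff.1 h)
    · simp only [sigmaC0, sigmaC1, decide_eq_decide] at hc
      exact sdiff_notMem_of_valid hv hy (hc.1 (sdiff_notMem_of_valid hv hx))

/-- **(Ω) gives strict (Σ) on an instance without disjoint or covering pairs**: for a valid
instance with at least three members relative to a ground set `U` with a point, no two of whose
members are disjoint or cover `U`, `|X| + 1 ≤ |sigmaD U X|`. -/
theorem card_add_one_le_card_sigmaD_of_conjOmega (hΩ : ConjOmega α) (hv : SigmaValidRel U X)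
    (hp : p ∈ U) (h3 : 3 ≤ X.card)
    (hdisj : ∀ x ∈ X, ∀ y ∈ X, x ≠ y → x ⊓ y ≠ ∅)
    (hcov : ∀ x ∈ X, ∀ y ∈ X, x ≠ y → x ⊔ y ≠ U) :
    X.card + 1 ≤ (sigmaD U X).card := by
  set F := sigmaOmegaFam U p X with hF
  have hsub : ∀ s ∈ F, s ⊆ U.erase p := fun s hs => subset_erase_of_mem_sigmaOmegaFam hv hs
  have hcard : F.card = X.card := card_sigmaOmegaFam hv
  have hΩF := hΩ (U.erase p) F (sigmaC0 X) (sigmaC1 X) hsub (hcard ▸ h3)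
  -- the two parts of `sigmaD U X`
  have hsplit := card_filter_add_card_filter_not (s := sigmaD U X) (fun d => p ∈ d)
  -- the `A`-family misses `∅`, which is in the `p`-free part
  have hempty : ∅ ∈ (sigmaD U X).filter fun d => ¬ p ∈ d :=
    mem_filter.2 ⟨empty_mem_sigmaD U X, notMem_empty p⟩
  have hA : (omegaA F (sigmaC0 X) (sigmaC1 X)).card + 1 ≤
      ((sigmaD U X).filter fun d => ¬ p ∈ d).card := by
    have hsubA : omegaA F (sigmaC0 X) (sigmaC1 X) ⊆
        ((sigmaD U X).filter fun d => ¬ p ∈ d).erase ∅ :=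
      subset_erase.2 ⟨omegaA_sigmaOmegaFam_subset hv,
        empty_notMem_omegaA_sigmaOmegaFam hv hdisj hcov⟩
    have := card_le_card hsubA
    rw [card_erase_of_mem hempty] at this
    have hpos : 0 < ((sigmaD U X).filter fun d => ¬ p ∈ d).card := card_pos.2 ⟨∅, hempty⟩
    omega
  have hC : (omegaC (U.erase p) F (sigmaC1 X)).card ≤ ((sigmaD U X).filter fun d => p ∈ d).card := by
    have hinj : Set.InjOn (insert p) (omegaC (U.erase p) F (sigmaC1 X) : Set (Finset α)) := by
      intro d hd e he hde
      have hpd : p ∉ d := fun h => (mem_erase.1 (subset_of_mem_omegaC (mem_coe.1 hd) h)).1 rfl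
      have hpe : p ∉ e := fun h => (mem_erase.1 (subset_of_mem_omegaC (mem_coe.1 he) h)).1 rfl
      rw [← erase_insert hpd, hde, erase_insert hpe]
    calc (omegaC (U.erase p) F (sigmaC1 X)).card
        = ((omegaC (U.erase p) F (sigmaC1 X)).image (insert p)).card :=
          (card_image_of_injOn hinj).symm
      _ ≤ _ := card_le_card (omegaC_sigmaOmegaFam_subset hv hp)
  unfold omegaCount at hΩF
  omega

/-- **(Σ) is strict on every intersecting, co-intersecting instance with at least three members**:
for a valid family `X` of subsets of `α` with `|X| ≥ 3`, no two of whose members are disjoint or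
cover `univ`, `|X| + 1 ≤ |sigmaD univ X|` — unconditionally, through `conjOmega_holds`. -/
theorem card_add_one_le_card_sigmaD [Fintype α] (hv : SigmaValidRel univ X) (h3 : 3 ≤ X.card)
    (hdisj : ∀ x ∈ X, ∀ y ∈ X, x ≠ y → x ⊓ y ≠ ∅)
    (hcov : ∀ x ∈ X, ∀ y ∈ X, x ≠ y → x ⊔ y ≠ univ) :
    X.card + 1 ≤ (sigmaD univ X).card := by
  -- the ground set has a point: otherwise `X ⊆ {∅}` has at most one member
  obtain ⟨p, hp⟩ : (univ : Finset α).Nonempty := by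
    by_contra h
    rw [not_nonempty_iff_eq_empty] at h
    have : X ⊆ {∅} := by
      intro x hx
      have := hv.1 x hx
      rw [h, subset_empty] at this
      rw [this]
      exact mem_singleton_self _
    have := card_le_card this
    simp at this
    omega
  exact card_add_one_le_card_sigmaD_of_conjOmega conjOmega_holds hv hp h3 hdisj hcov

end SigmaStrict

end PercRepro.MSTight
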